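import Literature.MathematicalPhysics.QuantumLattice.KomaPiFluxCoulombKLSInequality
import HarnessLib

/-!
# The momentum-resolved double commutator of Koma's `π`-flux BCS model (Koma 2022, (6.25)–(6.28)),
# and its POINTWISE hopping bound

T. Koma, *Nambu–Goldstone modes for superconducting lattice fermions*, arXiv:2201.13135 (2022)
[Koma2022], §6: the double commutator `c_p = ⟨[Γ̂¹_{-p},[H,Γ̂¹_p]]⟩` is computed in (6.25)–(6.28)
FOR EVERY MOMENTUM `p`:

  `[Γ̂¹_{-p},[H_int,Γ̂¹_p]] = -2g|Λ|⁻¹ΣₓΣₘ(Γ²ₓΓ²_{x+eₘ} + Γ²ₓΓ²_{x-eₘ})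
                             + 2g|Λ|⁻¹ΣₓΣₘ(Γ³ₓΓ³_{x+eₘ}e^{ipₘ} + Γ³ₓΓ³_{x-eₘ}e^{-ipₘ})`     (6.28)

and `‖[Γ̂¹_{-p},[H_hop,Γ̂¹_p]]‖ ≤ 8d|κ|` (6.26). Koma then AVERAGES over `p` ((6.29)–(6.33); tree:
`KomaPiFluxDoubleCommutatorSumRule.lean`, where the `Γ³Γ³` term drops by `Σ_p e^{ip_m} = 0`). The
Kennedy–Lieb–Shastry ground-state argument in two dimensions [KLS1988PRL, eqs. (4)–(7)] needs the
momentum-RESOLVED form, which this file records in the Lieb frame of this series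
(`KomaPiFlux.hamiltonian κ U g 0 0`, ferromagnetic `η`-XY pair term, order at `p = 0`), for the real
modes `C_p = Σₓcos(p·x)Γ¹ₓ`, `S_p = Σₓsin(p·x)Γ¹ₓ`:

* `PairHopRP.gammaOne_doubleComm_pairInteraction_of_ne` — the OFF-DIAGONAL local double commutator
  `[Γ¹_x,[H_pair(g,0),Γ¹_y]] = -2g Γ³_xΓ³_y` for adjacent `x ≠ y` (zero for non-adjacent `x ≠ y`);
  with the diagonal `2gΣ_{z∼x}Γ²_xΓ²_z` of `KomaPiFluxDoubleCommutator.lean` this is (6.28) in real space;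
* `PairHopRP.gammaOne_doubleComm_hopping_of_ne` — the off-diagonal hopping double commutator
  `[Γ¹_x,[K(T),Γ¹_y]] = T_↑(x,y)c†_{y↓}c_{x↓} + T_↓(x,y)c†_{y↑}c_{x↑} + T_↑(y,x)c†_{x↓}c_{y↓} + T_↓(y,x)c†_{x↑}c_{y↑}`
  (`x ∼ y`; zero otherwise), from the bond-pair commutators of `KomaPiFluxHoppingDoubleCommutator.lean`;
* `KomaPiFlux.modes_doubleCommOp_eq` — the OPERATOR identity behind (6.28), for `H₀ = H(κ,U,g,0,0)` on
  the torus of side `L ≥ 3`: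
  `Σ_{A=C_p,S_p} (A[H₀,A] - [H₀,A]A) = hopDC κ p + 4g Σ_μΣ_x Γ²_xΓ²_{x+e_μ} - 4g Σ_μ cos(p_μ) Σ_x Γ³_xΓ³_{x+e_μ}`,
  and its expectation in ANY linear functional (`KomaPiFlux.re_modes_doubleComm_eq`; for Gibbs states
  `KomaPiFlux.doubleComm_modes_pointwise_eq`);
* `KomaPiFlux.abs_re_gibbsState_hopDC_le` — the pointwise hopping bound
  `|Re⟨hopDC κ p⟩_{β,H'}| ≤ 16(d+1)κ L^{d+1}` in the Gibbs state of any Hermitian `H'` (Koma's (6.26)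
  has `8d|κ|` per site by pairing terms into norm-one combinations; here every elementary hopping
  expectation is bounded separately by `|Re⟨T_π c†c⟩| ≤ κ`: `8Dκ` per site from the diagonal `-2K`,
  `4κ` per ordered bond from the off-diagonal kernel).

Everything is PROVED; no named fact. WHAT THIS IS NOT: no infrared bound, no long-range order; the
`p`-average (6.29)–(6.33) is the sibling file `KomaPiFluxDoubleCommutatorSumRule.lean`.

## References

* [Koma2022] T. Koma, arXiv:2201.13135, (6.15), (6.25)–(6.28).
* [KLS1988PRL] T. Kennedy, E. H. Lieb, B. S. Shastry, Phys. Rev. Lett. 61 (1988) 2582, eqs. (4)–(7).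
-/

noncomputable section

namespace Literature.MathematicalPhysics.QuantumLattice

open Matrix Finset HubbardWave0 PairHopRP FermionTorus LiebCutRP
open Literature.Probability.LatticeModels
open scoped ComplexOrder

namespace PairHopRP

variable {Λ : Type*} [LinearOrder Λ] [Fintype Λ]

/-! ### `Γ¹_x` commutes with pair operators living on other sites -/

/-- `Γ⁺_x` commutes with any product of two creators. [cite: Koma2022, (6.25)] -/
theorem gammaPlus_comm_creation_mul_creation (x : Λ) (p q : Orb Λ) :
    gammaPlus x * (creation p * creation q) = creation p * creation q * gammaPlus x := by
  rw [gammaPlus, Matrix.mul_assoc, creation_comm_pair (orb x 1) p q, ← Matrix.mul_assoc,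
    creation_comm_pair (orb x 0) p q, Matrix.mul_assoc]

/-- `Γ⁻_x` commutes with a product of two creators on other orbitals. [cite: Koma2022, (6.25)] -/
theorem gammaMinus_comm_creation_mul_creation {x : Λ} {p q : Orb Λ} (hp0 : orb x 0 ≠ p) (hq0 : orb x 0 ≠ q)
    (hp1 : orb x 1 ≠ p) (hq1 : orb x 1 ≠ q) :
    gammaMinus x * (creation p * creation q) = creation p * creation q * gammaMinus x := by
  rw [gammaMinus, Matrix.mul_assoc, annihilation_comm_pair hp0 hq0, ← Matrix.mul_assoc,
    annihilation_comm_pair hp1 hq1, Matrix.mul_assoc]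

/-- `Γ¹_x` commutes with `c†_{aσ}c†_{bτ}` for `a, b ≠ x`. [cite: Koma2022, (6.25)] -/
theorem gammaOne_comm_creation_mul_creation {x a b : Λ} (ha : a ≠ x) (hb : b ≠ x) (σ τ : Fin 2) :
    gammaOne x * (creation (orb a σ) * creation (orb b τ)) = creation (orb a σ) * creation (orb b τ) * gammaOne x := by
  have h1 : ∀ (s : Fin 2), orb x s ≠ orb a σ := fun s h => ha (orb_eq_orb_iff.1 h).1.symm
  have h2 : ∀ (s : Fin 2), orb x s ≠ orb b τ := fun s h => hb (orb_eq_orb_iff.1 h).1.symm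
  rw [gammaOne, Matrix.add_mul, Matrix.mul_add, gammaPlus_comm_creation_mul_creation,
    gammaMinus_comm_creation_mul_creation (h1 0) (h2 0) (h1 1) (h2 1)]

/-- `Γ¹_x` commutes with `c_{aσ}c_{bτ}` for `a, b ≠ x`. [cite: Koma2022, (6.25)] -/
theorem gammaOne_comm_annihilation_mul_annihilation {x a b : Λ} (ha : a ≠ x) (hb : b ≠ x) (σ τ : Fin 2) :
    gammaOne x * (annihilation (orb a σ) * annihilation (orb b τ)) =
      annihilation (orb a σ) * annihilation (orb b τ) * gammaOne x := by
  have h := congrArg conjTranspose (gammaOne_comm_creation_mul_creation hb ha τ σ)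
  simp only [conjTranspose_mul, creation_conjTranspose, (gammaOne_isHermitian x).eq, Matrix.mul_assoc] at h
  rw [← Matrix.mul_assoc] at h
  exact h.symm

/-! ### The off-diagonal double commutator of the pair interaction: (6.28), real space -/

section Graph

variable (G : SimpleGraph Λ) [DecidableRel G.Adj]

/-- **`[Γ¹_x, [H_pair(g,0), Γ¹_y]] = -2g [x∼y] Γ³_xΓ³_y`** for `x ≠ y` (Lieb frame): the off-diagonal
part of Koma's (6.28) in real space (`[H_pair, Γ¹_y] = igΓ³_y Σ_{z∼y}Γ²_z`, and `[Γ¹_x, Γ²_z] = 2iδ_{xz}Γ³_x`).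
[cite: Koma2022, (6.27)–(6.28)] -/
theorem gammaOne_doubleComm_pairInteraction_of_ne {x y : Λ} (hxy : x ≠ y) (g : ℝ) :
    gammaOne x * (pairInteraction G g (fun _ _ => 0) * gammaOne y - gammaOne y * pairInteraction G g (fun _ _ => 0)) -
        (pairInteraction G g (fun _ _ => 0) * gammaOne y - gammaOne y * pairInteraction G g (fun _ _ => 0)) * gammaOne x =
      ((-(2 * g) : ℝ) : ℂ) • (if G.Adj x y then gammaThree x * gammaThree y else 0) := by
  rw [pairInteraction_comm_gammaOne, Matrix.mul_smul, Matrix.smul_mul, ← smul_sub, Finset.mul_sum, Finset.sum_mul,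
    ← Finset.sum_sub_distrib]
  have hpt : ∀ z : Λ, gammaOne x * (if G.Adj y z then gammaThree y * gammaTwo z else 0) -
      (if G.Adj y z then gammaThree y * gammaTwo z else 0) * gammaOne x =
      if z = x then (if G.Adj y x then (2 * Complex.I) • (gammaThree x * gammaThree y) else 0) else 0 := by
    intro z
    by_cases hz : z = x
    · subst hz
      rw [if_pos rfl]
      split_ifs
      · rw [← Matrix.mul_assoc, ← gammaThree_comm_gammaOne_of_ne (Ne.symm hxy), Matrix.mul_assoc, Matrix.mul_assoc,
          ← Matrix.mul_sub, gammaOne_comm_gammaTwo, Matrix.mul_smul, (gammaThree_commute y z).eq]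
      · rw [Matrix.mul_zero, Matrix.zero_mul, sub_zero]
    · rw [if_neg hz]
      split_ifs
      · rw [← Matrix.mul_assoc, ← gammaThree_comm_gammaOne_of_ne (Ne.symm hxy), Matrix.mul_assoc, Matrix.mul_assoc,
          gammaOne_comm_gammaTwo_of_ne (Ne.symm hz), sub_self]
      · rw [Matrix.mul_zero, Matrix.zero_mul, sub_zero]
  simp only [hpt]
  rw [Finset.sum_ite_eq' Finset.univ x, if_pos (Finset.mem_univ x)]
  by_cases hadj : G.Adj x y
  · rw [if_pos hadj, if_pos hadj.symm, smul_smul]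
    congr 1
    push_cast
    linear_combination (2 * (g : ℂ)) * Complex.I_mul_I
  · rw [if_neg hadj, if_neg (fun h => hadj h.symm), smul_zero, smul_zero]

/-! ### The off-diagonal hopping double commutator: (6.25)–(6.26), real space -/

/-- **`[Γ¹_x, [K(T), Γ¹_y]]` for `x ≠ y`**: only the bond `{x, y}` contributes, with
`[Γ¹_x, [K(T), Γ¹_y]] = T_↑(x,y) c†_{y↓}c_{x↓} + T_↓(x,y) c†_{y↑}c_{x↑} + T_↑(y,x) c†_{x↓}c_{y↓} + T_↓(y,x) c†_{x↑}c_{y↑}`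
if `x ∼ y` and `0` otherwise. [cite: Koma2022, (6.25)–(6.26)] -/
theorem gammaOne_doubleComm_hopping_of_ne {x y : Λ} (hxy : x ≠ y) (T : Fin 2 → Λ → Λ → ℂ) :
    gammaOne x * (peierlsHubbard G T 0 * gammaOne y - gammaOne y * peierlsHubbard G T 0) -
        (peierlsHubbard G T 0 * gammaOne y - gammaOne y * peierlsHubbard G T 0) * gammaOne x =
      if G.Adj x y then
        T 0 x y • (creation (orb y 1) * annihilation (orb x 1)) + T 1 x y • (creation (orb y 0) * annihilation (orb x 0)) +
          T 0 y x • (creation (orb x 1) * annihilation (orb y 1)) + T 1 y x • (creation (orb x 0) * annihilation (orb y 0))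
      else 0 := by
  have hyx : y ≠ x := Ne.symm hxy
  -- `[K, Γ¹_y] = [K, Γ⁺_y] + [K, Γ⁻_y]`
  have hsplit : peierlsHubbard G T 0 * gammaOne y - gammaOne y * peierlsHubbard G T 0 =
      -(∑ a : Λ, if G.Adj a y then
          T 0 a y • (creation (orb a 0) * creation (orb y 1)) + T 1 a y • (creation (orb y 0) * creation (orb a 1)) else 0) +
        ∑ b : Λ, if G.Adj y b then
          T 0 y b • (annihilation (orb y 1) * annihilation (orb b 0)) + T 1 y b • (annihilation (orb b 1) * annihilation (orb y 0))
        else 0 := by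
    rw [gammaOne, Matrix.mul_add, Matrix.add_mul, ← hopping_comm_gammaPlus G T y, ← hopping_comm_gammaMinus G T y]
    abel
  -- the commutator with `Γ¹_x` of each term
  have hcre : ∀ a : Λ, gammaOne x * (if G.Adj a y then
      T 0 a y • (creation (orb a 0) * creation (orb y 1)) + T 1 a y • (creation (orb y 0) * creation (orb a 1)) else 0) -
      (if G.Adj a y then
        T 0 a y • (creation (orb a 0) * creation (orb y 1)) + T 1 a y • (creation (orb y 0) * creation (orb a 1)) else 0) *
        gammaOne x =
      if a = x then (if G.Adj x y then
        -(T 0 x y • (creation (orb y 1) * annihilation (orb x 1))) - T 1 x y • (creation (orb y 0) * annihilation (orb x 0))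
        else 0) else 0 := by
    intro a
    by_cases ha : a = x
    · subst ha
      rw [if_pos rfl]
      by_cases hadj : G.Adj a y
      · rw [if_pos hadj, if_pos hadj, Matrix.mul_add, Matrix.add_mul, Matrix.mul_smul, Matrix.mul_smul, Matrix.smul_mul,
          Matrix.smul_mul]
        have e0 : gammaOne a * (creation (orb a 0) * creation (orb y 1)) - creation (orb a 0) * creation (orb y 1) * gammaOne a =
            -(creation (orb y 1) * annihilation (orb a 1)) := by
          have h1 := gammaPlus_comm_pairCre1 y a
          have h2 := gammaMinus_comm_pairCre1 hyx
          rw [gammaOne, Matrix.add_mul, Matrix.mul_add,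
            show ∀ (A B C D : Matrix (Finset (Orb Λ)) (Finset (Orb Λ)) ℂ), A + B - (C + D) = (A - C) + (B - D) from
              fun _ _ _ _ => by abel, h1, h2, zero_add]
        have e1 : gammaOne a * (creation (orb y 0) * creation (orb a 1)) - creation (orb y 0) * creation (orb a 1) * gammaOne a =
            -(creation (orb y 0) * annihilation (orb a 0)) := by
          have h1 := gammaPlus_comm_pairCre0 y a
          have h2 := gammaMinus_comm_pairCre0 hyx
          rw [gammaOne, Matrix.add_mul, Matrix.mul_add,
            show ∀ (A B C D : Matrix (Finset (Orb Λ)) (Finset (Orb Λ)) ℂ), A + B - (C + D) = (A - C) + (B - D) from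
              fun _ _ _ _ => by abel, h1, h2, zero_add]
        rw [show ∀ (A B C D : Matrix (Finset (Orb Λ)) (Finset (Orb Λ)) ℂ) (s t : ℂ),
            s • A + t • B - (s • C + t • D) = s • (A - C) + t • (B - D) from fun _ _ _ _ _ _ => by
              rw [smul_sub, smul_sub]; abel, e0, e1, smul_neg, smul_neg]
        abel
      · rw [if_neg hadj, if_neg hadj, Matrix.mul_zero, Matrix.zero_mul, sub_zero]
    · rw [if_neg ha]
      split_ifs
      · rw [Matrix.mul_add, Matrix.add_mul, Matrix.mul_smul, Matrix.mul_smul, Matrix.smul_mul, Matrix.smul_mul,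
          gammaOne_comm_creation_mul_creation ha hyx, gammaOne_comm_creation_mul_creation hyx ha, sub_self]
      · rw [Matrix.mul_zero, Matrix.zero_mul, sub_zero]
  have hann : ∀ b : Λ, gammaOne x * (if G.Adj y b then
      T 0 y b • (annihilation (orb y 1) * annihilation (orb b 0)) + T 1 y b • (annihilation (orb b 1) * annihilation (orb y 0))
        else 0) -
      (if G.Adj y b then
        T 0 y b • (annihilation (orb y 1) * annihilation (orb b 0)) + T 1 y b • (annihilation (orb b 1) * annihilation (orb y 0))
        else 0) * gammaOne x =
      if b = x then (if G.Adj x y then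
        T 0 y x • (creation (orb x 1) * annihilation (orb y 1)) + T 1 y x • (creation (orb x 0) * annihilation (orb y 0))
        else 0) else 0 := by
    intro b
    by_cases hb : b = x
    · subst hb
      rw [if_pos rfl]
      by_cases hadj : G.Adj b y
      · rw [if_pos hadj.symm, if_pos hadj, Matrix.mul_add, Matrix.add_mul, Matrix.mul_smul, Matrix.mul_smul, Matrix.smul_mul,
          Matrix.smul_mul]
        have e0 : gammaOne b * (annihilation (orb y 1) * annihilation (orb b 0)) -
            annihilation (orb y 1) * annihilation (orb b 0) * gammaOne b = creation (orb b 1) * annihilation (orb y 1) := by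
          have h1 := gammaPlus_comm_pairAnn1 hyx
          have h2 := gammaMinus_comm_pairAnn1 y b
          rw [gammaOne, Matrix.add_mul, Matrix.mul_add,
            show ∀ (A B C D : Matrix (Finset (Orb Λ)) (Finset (Orb Λ)) ℂ), A + B - (C + D) = (A - C) + (B - D) from
              fun _ _ _ _ => by abel, h1, h2, add_zero]
        have e1 : gammaOne b * (annihilation (orb b 1) * annihilation (orb y 0)) -
            annihilation (orb b 1) * annihilation (orb y 0) * gammaOne b = creation (orb b 0) * annihilation (orb y 0) := by
          have h1 := gammaPlus_comm_pairAnn0 hyx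
          have h2 := gammaMinus_comm_pairAnn0 y b
          rw [gammaOne, Matrix.add_mul, Matrix.mul_add,
            show ∀ (A B C D : Matrix (Finset (Orb Λ)) (Finset (Orb Λ)) ℂ), A + B - (C + D) = (A - C) + (B - D) from
              fun _ _ _ _ => by abel, h1, h2, add_zero]
        rw [show ∀ (A B C D : Matrix (Finset (Orb Λ)) (Finset (Orb Λ)) ℂ) (s t : ℂ),
            s • A + t • B - (s • C + t • D) = s • (A - C) + t • (B - D) from fun _ _ _ _ _ _ => by
              rw [smul_sub, smul_sub]; abel, e0, e1]
      · rw [if_neg (fun h => hadj h.symm), if_neg hadj, Matrix.mul_zero, Matrix.zero_mul, sub_zero]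
    · rw [if_neg hb]
      split_ifs
      · rw [Matrix.mul_add, Matrix.add_mul, Matrix.mul_smul, Matrix.mul_smul, Matrix.smul_mul, Matrix.smul_mul,
          gammaOne_comm_annihilation_mul_annihilation hyx hb, gammaOne_comm_annihilation_mul_annihilation hb hyx, sub_self]
      · rw [Matrix.mul_zero, Matrix.zero_mul, sub_zero]
  rw [hsplit, Matrix.mul_add, Matrix.add_mul, Matrix.mul_neg, Matrix.neg_mul,
    show ∀ (A B C D : Matrix (Finset (Orb Λ)) (Finset (Orb Λ)) ℂ), -A + B - (-C + D) = -(A - C) + (B - D) from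
      fun _ _ _ _ => by abel,
    Finset.mul_sum, Finset.sum_mul, ← Finset.sum_sub_distrib, Finset.mul_sum, Finset.sum_mul, ← Finset.sum_sub_distrib]
  simp only [hcre, hann]
  rw [Finset.sum_ite_eq' Finset.univ x, if_pos (Finset.mem_univ x), Finset.sum_ite_eq' Finset.univ x,
    if_pos (Finset.mem_univ x)]
  split_ifs
  · rw [neg_sub, sub_neg_eq_add]
    abel
  · rw [neg_zero, zero_add]

/-- **The off-diagonal double commutator of the full Hamiltonian at `h = 0`, `B = 0`**:
`[Γ¹_x,[H₀,Γ¹_y]] = [Γ¹_x,[K(T),Γ¹_y]] - 2g[x∼y]Γ³_xΓ³_y` (`x ≠ y`; the `U` term drops out).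
[cite: Koma2022, (6.25)–(6.28)] -/
theorem gammaOne_doubleComm_hamiltonian_of_ne {x y : Λ} (hxy : x ≠ y) (T : Fin 2 → Λ → Λ → ℂ) (U g : ℝ) :
    gammaOne x * (hamiltonian G T U g (fun _ _ => 0) 0 * gammaOne y - gammaOne y * hamiltonian G T U g (fun _ _ => 0) 0) -
        (hamiltonian G T U g (fun _ _ => 0) 0 * gammaOne y - gammaOne y * hamiltonian G T U g (fun _ _ => 0) 0) *
          gammaOne x =
      (gammaOne x * (peierlsHubbard G T 0 * gammaOne y - gammaOne y * peierlsHubbard G T 0) -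
          (peierlsHubbard G T 0 * gammaOne y - gammaOne y * peierlsHubbard G T 0) * gammaOne x) +
        ((-(2 * g) : ℝ) : ℂ) • (if G.Adj x y then gammaThree x * gammaThree y else 0) := by
  have hK := peierlsHubbard_comm_gammaOne_eq G T U y
  have hP := gammaOne_doubleComm_pairInteraction_of_ne G hxy g
  have hsplit : hamiltonian G T U g (fun _ _ => 0) 0 * gammaOne y - gammaOne y * hamiltonian G T U g (fun _ _ => 0) 0 =
      (peierlsHubbard G T 0 * gammaOne y - gammaOne y * peierlsHubbard G T 0) +
        (pairInteraction G g (fun _ _ => 0) * gammaOne y - gammaOne y * pairInteraction G g (fun _ _ => 0)) := by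
    rw [hamiltonian, Complex.ofReal_zero, zero_smul, sub_zero, Matrix.add_mul, Matrix.mul_add, ← hK]
    abel
  rw [hsplit, Matrix.mul_add, Matrix.add_mul, ← hP]
  abel

end Graph

end PairHopRP

/-! ### The torus: the momentum-resolved double commutator of the modes -/

namespace KomaPiFlux

attribute [local instance] LiebCutRP.decEqTorus

variable {d L : ℕ} [NeZero L]

/-- The local double commutator operator `Γ¹_x (HΓ¹_y - Γ¹_yH) - (HΓ¹_y - Γ¹_yH) Γ¹_x = [Γ¹_x,[H,Γ¹_y]]`.
[cite: Koma2022, (6.15), (6.25)] -/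
def dcOp (H : Matrix (Finset (Orb (FermionTorus (d + 1) L))) (Finset (Orb (FermionTorus (d + 1) L))) ℂ)
    (x y : FermionTorus (d + 1) L) : Matrix (Finset (Orb (FermionTorus (d + 1) L))) (Finset (Orb (FermionTorus (d + 1) L))) ℂ :=
  gammaOne x * (H * gammaOne y - gammaOne y * H) - (H * gammaOne y - gammaOne y * H) * gammaOne x

/-- The double commutator operator `A(HA - AH) - (HA - AH)A = [A,[H,A]]` of a mode `A`.
[cite: Koma2022, (6.15)] -/
def modeDC (H A : Matrix (Finset (Orb (FermionTorus (d + 1) L))) (Finset (Orb (FermionTorus (d + 1) L))) ℂ) :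
    Matrix (Finset (Orb (FermionTorus (d + 1) L))) (Finset (Orb (FermionTorus (d + 1) L))) ℂ :=
  A * (H * A - A * H) - (H * A - A * H) * A

omit [NeZero L] in
/-- `doubleComm β H A = Re⟨modeDC H A⟩_{β,H}`. [cite: Koma2022, (6.15)] -/
theorem doubleComm_eq_re_gibbsState_modeDC (β : ℝ)
    (H A : Matrix (Finset (Orb (FermionTorus (d + 1) L))) (Finset (Orb (FermionTorus (d + 1) L))) ℂ) :
    doubleComm β H A = (gibbsState β H (modeDC H A)).re := rfl

omit [NeZero L] in
/-- **Bilinear expansion**: `[Γ¹[c],[H,Γ¹[c]]] = Σ_{x,y} c(x)c(y) [Γ¹_x,[H,Γ¹_y]]`. [cite: Koma2022, (6.15)] -/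
theorem modeDC_gammaOneMode (H : Matrix (Finset (Orb (FermionTorus (d + 1) L))) (Finset (Orb (FermionTorus (d + 1) L))) ℂ)
    (c : FermionTorus (d + 1) L → ℝ) :
    modeDC H (gammaOneMode c) =
      ∑ x : FermionTorus (d + 1) L, ∑ y : FermionTorus (d + 1) L, ((c x * c y : ℝ) : ℂ) • dcOp H x y := by
  have hcomm : H * gammaOneMode c - gammaOneMode c * H =
      ∑ y : FermionTorus (d + 1) L, (c y : ℂ) • (H * gammaOne y - gammaOne y * H) := by
    unfold gammaOneMode
    rw [Finset.mul_sum, Finset.sum_mul, ← Finset.sum_sub_distrib]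
    refine Finset.sum_congr rfl fun y _ => ?_
    rw [Matrix.mul_smul, Matrix.smul_mul, smul_sub]
  have h1 : gammaOneMode c * (H * gammaOneMode c - gammaOneMode c * H) =
      ∑ x : FermionTorus (d + 1) L, ∑ y : FermionTorus (d + 1) L,
        ((c x * c y : ℝ) : ℂ) • (gammaOne x * (H * gammaOne y - gammaOne y * H)) := by
    rw [hcomm]
    unfold gammaOneMode
    rw [Finset.sum_mul]
    refine Finset.sum_congr rfl fun x _ => ?_
    rw [Finset.mul_sum]
    refine Finset.sum_congr rfl fun y _ => ?_
    rw [Matrix.smul_mul, Matrix.mul_smul, smul_smul, Complex.ofReal_mul]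
  have h2 : (H * gammaOneMode c - gammaOneMode c * H) * gammaOneMode c =
      ∑ x : FermionTorus (d + 1) L, ∑ y : FermionTorus (d + 1) L,
        ((c x * c y : ℝ) : ℂ) • ((H * gammaOne y - gammaOne y * H) * gammaOne x) := by
    rw [hcomm]
    unfold gammaOneMode
    rw [Finset.sum_mul]
    simp_rw [Finset.mul_sum]
    rw [Finset.sum_comm]
    refine Finset.sum_congr rfl fun x _ => ?_
    refine Finset.sum_congr rfl fun y _ => ?_
    rw [Matrix.smul_mul, Matrix.mul_smul, smul_smul, Complex.ofReal_mul, mul_comm (c y : ℂ)]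
  rw [modeDC, h1, h2, ← Finset.sum_sub_distrib]
  refine Finset.sum_congr rfl fun x _ => ?_
  rw [← Finset.sum_sub_distrib]
  refine Finset.sum_congr rfl fun y _ => ?_
  rw [← smul_sub, dcOp]

/-- The two real modes at momentum `p` together:
`[C_p,[H,C_p]] + [S_p,[H,S_p]] = Σ_{x,y} cos(p·(x̄-ȳ)) [Γ¹_x,[H,Γ¹_y]]`. [cite: Koma2022, (6.15)] -/
theorem modeDC_modes_eq (H : Matrix (Finset (Orb (FermionTorus (d + 1) L))) (Finset (Orb (FermionTorus (d + 1) L))) ℂ)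
    (p : TorusSite (d + 1) L) :
    modeDC H (gammaOneMode (cosWave p)) + modeDC H (gammaOneMode (sinWave p)) =
      ∑ x : FermionTorus (d + 1) L, ∑ y : FermionTorus (d + 1) L,
        (Real.cos (torusPhase L p (toTorusSite x - toTorusSite y)) : ℂ) • dcOp H x y := by
  rw [modeDC_gammaOneMode, modeDC_gammaOneMode, ← Finset.sum_add_distrib]
  refine Finset.sum_congr rfl fun x _ => ?_
  rw [← Finset.sum_add_distrib]
  refine Finset.sum_congr rfl fun y _ => ?_
  rw [← add_smul, ← Complex.ofReal_add, cosWave, cosWave, sinWave, sinWave, cos_torusPhase_sub L]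

/-- **The momentum-resolved hopping double commutator** (operator):
`hopDC κ p = Σ_{x,y} cos(p·(x̄-ȳ)) [Γ¹_x,[K(T_π(κ)),Γ¹_y]]`. [cite: Koma2022, (6.25)–(6.26)] -/
def hopDC (κ : ℝ) (p : TorusSite (d + 1) L) :
    Matrix (Finset (Orb (FermionTorus (d + 1) L))) (Finset (Orb (FermionTorus (d + 1) L))) ℂ :=
  ∑ x : FermionTorus (d + 1) L, ∑ y : FermionTorus (d + 1) L,
    (Real.cos (torusPhase L p (toTorusSite x - toTorusSite y)) : ℂ) • dcOp (peierlsHubbard (G d L) (piFluxAmpl κ) 0) x y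

/-- `cos(p·(x̄ - (x̄+e_μ))) = cos p_μ` (the phase `e^{-ip_m}` of (6.28)). [cite: Koma2022, (6.28)] -/
theorem cos_torusPhase_self_sub_shift (p : TorusSite (d + 1) L) (x : FermionTorus (d + 1) L) (μ : Fin (d + 1)) :
    Real.cos (torusPhase L p (toTorusSite x - toTorusSite (shift x μ))) = Real.cos (latticeMomentum L p μ) := by
  rw [toTorusSite_shift, sub_add_eq_sub_sub, sub_self, zero_sub, cos_torusPhase_neg_single]

/-- `cos(p·((x̄+e_μ) - x̄)) = cos p_μ` (the phase `e^{ip_m}` of (6.28)). [cite: Koma2022, (6.28)] -/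
theorem cos_torusPhase_shift_sub_self (p : TorusSite (d + 1) L) (x : FermionTorus (d + 1) L) (μ : Fin (d + 1)) :
    Real.cos (torusPhase L p (toTorusSite (shift x μ) - toTorusSite x)) = Real.cos (latticeMomentum L p μ) := by
  rw [← cos_torusPhase_self_sub_shift p x μ, cos_torusPhase_sub, cos_torusPhase_sub]
  ring

omit [NeZero L] in
/-- `p · 0 = 0`. [folklore] -/
private theorem torusPhase_zero_right (p : TorusSite (d + 1) L) : torusPhase L p (0 : TorusSite (d + 1) L) = 0 := by
  simp [torusPhase, ZMod.val_zero]

/-- **Koma's (6.28), momentum-resolved, as an OPERATOR identity in the Lieb frame** (`L ≥ 3`): for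
`H₀ = H(κ, U, g; 0, 0)`,
`[C_p,[H₀,C_p]] + [S_p,[H₀,S_p]] = hopDC κ p + 4g Σ_μΣ_x Γ²_xΓ²_{x+e_μ} - 4g Σ_μ cos(p_μ) Σ_x Γ³_xΓ³_{x+e_μ}`.
[cite: Koma2022, (6.25)–(6.28)] -/
theorem modes_doubleCommOp_eq (h3 : 3 ≤ L) (κ U g : ℝ) (p : TorusSite (d + 1) L) :
    modeDC (hamiltonian κ U g (fun (_ _ : FermionTorus (d + 1) L) => (0 : ℝ)) 0) (gammaOneMode (cosWave p)) +
        modeDC (hamiltonian κ U g (fun (_ _ : FermionTorus (d + 1) L) => (0 : ℝ)) 0) (gammaOneMode (sinWave p)) =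
      hopDC κ p +
        ((4 * g : ℝ) : ℂ) • (∑ μ : Fin (d + 1), ∑ x : FermionTorus (d + 1) L, gammaTwo x * gammaTwo (shift x μ)) -
        ((4 * g : ℝ) : ℂ) • (∑ μ : Fin (d + 1), (Real.cos (latticeMomentum L p μ) : ℂ) •
          ∑ x : FermionTorus (d + 1) L, gammaThree x * gammaThree (shift x μ)) := by
  set H₀ := hamiltonian κ U g (fun (_ _ : FermionTorus (d + 1) L) => (0 : ℝ)) 0 with hH₀
  set K := peierlsHubbard (G d L) (piFluxAmpl κ) 0 with hK
  -- the three pieces of the local kernel: hopping, diagonal `Γ²Γ²`, off-diagonal `Γ³Γ³`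
  set D : FermionTorus (d + 1) L → FermionTorus (d + 1) L →
      Matrix (Finset (Orb (FermionTorus (d + 1) L))) (Finset (Orb (FermionTorus (d + 1) L))) ℂ :=
    fun x y => if x = y then ((2 * g : ℝ) : ℂ) • ∑ z : FermionTorus (d + 1) L,
      (if (G d L).Adj x z then gammaTwo x * gammaTwo z else 0) else 0 with hD
  set O : FermionTorus (d + 1) L → FermionTorus (d + 1) L →
      Matrix (Finset (Orb (FermionTorus (d + 1) L))) (Finset (Orb (FermionTorus (d + 1) L))) ℂ :=
    fun x y => if x = y then 0 else ((-(2 * g) : ℝ) : ℂ) • (if (G d L).Adj x y then gammaThree x * gammaThree y else 0)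
    with hO
  have hker : ∀ x y : FermionTorus (d + 1) L, dcOp H₀ x y = dcOp K x y + D x y + O x y := by
    intro x y
    by_cases hxy : x = y
    · subst hxy
      simp only [hD, hO, if_pos rfl, add_zero]
      rw [dcOp, dcOp, hH₀]
      unfold hamiltonian
      rw [gammaOne_doubleComm_hamiltonian (G d L) (piFluxAmpl κ) U g 0 x, mul_zero, Complex.ofReal_zero, zero_smul, add_zero]
    · simp only [hD, hO, if_neg hxy, add_zero]
      rw [dcOp, dcOp, hH₀]
      unfold hamiltonian
      rw [gammaOne_doubleComm_hamiltonian_of_ne (G d L) hxy (piFluxAmpl κ) U g]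
  -- split the bilinear sum accordingly
  have hsplit : ∑ x : FermionTorus (d + 1) L, ∑ y : FermionTorus (d + 1) L,
      (Real.cos (torusPhase L p (toTorusSite x - toTorusSite y)) : ℂ) • dcOp H₀ x y =
      hopDC κ p +
        ∑ x : FermionTorus (d + 1) L, ∑ y : FermionTorus (d + 1) L,
          (Real.cos (torusPhase L p (toTorusSite x - toTorusSite y)) : ℂ) • D x y +
        ∑ x : FermionTorus (d + 1) L, ∑ y : FermionTorus (d + 1) L,
          (Real.cos (torusPhase L p (toTorusSite x - toTorusSite y)) : ℂ) • O x y := by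
    rw [hopDC, ← hK, ← Finset.sum_add_distrib, ← Finset.sum_add_distrib]
    refine Finset.sum_congr rfl fun x _ => ?_
    rw [← Finset.sum_add_distrib, ← Finset.sum_add_distrib]
    refine Finset.sum_congr rfl fun y _ => ?_
    rw [hker, smul_add, smul_add]
  -- the diagonal piece
  have hT2 : ∑ x : FermionTorus (d + 1) L, ∑ y : FermionTorus (d + 1) L,
      (Real.cos (torusPhase L p (toTorusSite x - toTorusSite y)) : ℂ) • D x y =
      ((4 * g : ℝ) : ℂ) • (∑ μ : Fin (d + 1), ∑ x : FermionTorus (d + 1) L, gammaTwo x * gammaTwo (shift x μ)) := by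
    have hx : ∀ x : FermionTorus (d + 1) L, ∑ y : FermionTorus (d + 1) L,
        (Real.cos (torusPhase L p (toTorusSite x - toTorusSite y)) : ℂ) • D x y =
        ((2 * g : ℝ) : ℂ) • ∑ z : FermionTorus (d + 1) L, (if (G d L).Adj x z then gammaTwo x * gammaTwo z else 0) := by
      intro x
      simp only [hD, smul_ite, smul_zero, Finset.sum_ite_eq, Finset.mem_univ, if_true]
      rw [sub_self, torusPhase_zero_right, Real.cos_zero, Complex.ofReal_one, one_smul]
    simp_rw [hx]
    rw [← Finset.smul_sum, ← sum_shift_add_sum_shift_swap h3 (fun x z => gammaTwo x * gammaTwo z),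
      show ((4 * g : ℝ) : ℂ) = ((2 * g : ℝ) : ℂ) * 2 by push_cast; ring, mul_smul, Finset.sum_comm]
    congr 1
    rw [two_smul, ← Finset.sum_add_distrib]
    refine Finset.sum_congr rfl fun μ _ => ?_
    rw [← Finset.sum_add_distrib]
    refine Finset.sum_congr rfl fun x _ => ?_
    rw [gammaTwo_comm (shift x μ) x]
  -- the off-diagonal piece
  have hT3 : ∑ x : FermionTorus (d + 1) L, ∑ y : FermionTorus (d + 1) L,
      (Real.cos (torusPhase L p (toTorusSite x - toTorusSite y)) : ℂ) • O x y =
      -(((4 * g : ℝ) : ℂ) • (∑ μ : Fin (d + 1), (Real.cos (latticeMomentum L p μ) : ℂ) •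
          ∑ x : FermionTorus (d + 1) L, gammaThree x * gammaThree (shift x μ))) := by
    have hoff : ∀ x y : FermionTorus (d + 1) L,
        (Real.cos (torusPhase L p (toTorusSite x - toTorusSite y)) : ℂ) • O x y =
        if (G d L).Adj x y then
          ((-(2 * g) * Real.cos (torusPhase L p (toTorusSite x - toTorusSite y)) : ℝ) : ℂ) • (gammaThree x * gammaThree y)
        else 0 := by
      intro x y
      by_cases hxy : x = y
      · subst hxy; simp only [hO, if_pos rfl, if_neg (G d L).irrefl, smul_zero]
      · simp only [hO, if_neg hxy]
        split_ifs
        · rw [smul_smul, Complex.ofReal_mul, mul_comm]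
        · rw [smul_zero, smul_zero]
    simp_rw [hoff]
    rw [← sum_shift_add_sum_shift_swap h3 (fun x y =>
      ((-(2 * g) * Real.cos (torusPhase L p (toTorusSite x - toTorusSite y)) : ℝ) : ℂ) • (gammaThree x * gammaThree y))]
    simp_rw [cos_torusPhase_self_sub_shift, cos_torusPhase_shift_sub_self]
    rw [Finset.smul_sum, Finset.sum_comm, ← Finset.sum_neg_distrib]
    refine Finset.sum_congr rfl fun μ _ => ?_
    rw [smul_smul, Finset.smul_sum, ← Finset.sum_neg_distrib]
    refine Finset.sum_congr rfl fun x _ => ?_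
    rw [(gammaThree_commute (shift x μ) x).eq, ← two_smul ℂ, smul_smul, ← neg_smul]
    congr 1
    push_cast
    ring
  rw [modeDC_modes_eq, hsplit, hT2, hT3, ← sub_eq_add_neg]

/-- **(6.28) in any linear functional** (`L ≥ 3`): for every `ℂ`-linear `φ` (a Gibbs state, the
tracial ground state, …),
`Re φ([C_p,[H₀,C_p]] + [S_p,[H₀,S_p]]) = Re φ(hopDC κ p) + 4g Σ_μΣ_x Re φ(Γ²_xΓ²_{x+e_μ}) - 4g Σ_μ cos(p_μ) Σ_x Re φ(Γ³_xΓ³_{x+e_μ})`.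
[cite: Koma2022, (6.28)] -/
theorem re_modes_doubleComm_eq (h3 : 3 ≤ L) (κ U g : ℝ) (p : TorusSite (d + 1) L)
    (φ : Matrix (Finset (Orb (FermionTorus (d + 1) L))) (Finset (Orb (FermionTorus (d + 1) L))) ℂ →ₗ[ℂ] ℂ) :
    (φ (modeDC (hamiltonian κ U g (fun (_ _ : FermionTorus (d + 1) L) => (0 : ℝ)) 0) (gammaOneMode (cosWave p)))).re +
        (φ (modeDC (hamiltonian κ U g (fun (_ _ : FermionTorus (d + 1) L) => (0 : ℝ)) 0) (gammaOneMode (sinWave p)))).re =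
      (φ (hopDC κ p)).re +
        4 * g * ∑ μ : Fin (d + 1), ∑ x : FermionTorus (d + 1) L, (φ (gammaTwo x * gammaTwo (shift x μ))).re -
        4 * g * ∑ μ : Fin (d + 1), Real.cos (latticeMomentum L p μ) *
          ∑ x : FermionTorus (d + 1) L, (φ (gammaThree x * gammaThree (shift x μ))).re := by
  have h2 : (φ (((4 * g : ℝ) : ℂ) • (∑ μ : Fin (d + 1), ∑ x : FermionTorus (d + 1) L, gammaTwo x * gammaTwo (shift x μ)))).re =
      4 * g * ∑ μ : Fin (d + 1), ∑ x : FermionTorus (d + 1) L, (φ (gammaTwo x * gammaTwo (shift x μ))).re := by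
    rw [LinearMap.map_smul, smul_eq_mul, Complex.re_ofReal_mul, map_sum φ, Complex.re_sum]
    congr 1
    refine Finset.sum_congr rfl fun μ _ => ?_
    rw [map_sum φ, Complex.re_sum]
  have h3' : (φ (((4 * g : ℝ) : ℂ) • (∑ μ : Fin (d + 1), (Real.cos (latticeMomentum L p μ) : ℂ) •
      ∑ x : FermionTorus (d + 1) L, gammaThree x * gammaThree (shift x μ)))).re =
      4 * g * ∑ μ : Fin (d + 1), Real.cos (latticeMomentum L p μ) *
        ∑ x : FermionTorus (d + 1) L, (φ (gammaThree x * gammaThree (shift x μ))).re := by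
    rw [LinearMap.map_smul, smul_eq_mul, Complex.re_ofReal_mul, map_sum φ, Complex.re_sum]
    congr 1
    refine Finset.sum_congr rfl fun μ _ => ?_
    rw [LinearMap.map_smul, smul_eq_mul, Complex.re_ofReal_mul, map_sum φ, Complex.re_sum]
  rw [← Complex.add_re, ← map_add, modes_doubleCommOp_eq h3, map_sub, map_add, Complex.sub_re, Complex.add_re, h2, h3']

/-! ### The pointwise hopping bound (6.26) -/

omit [NeZero L] in
/-- `|Λ| = L^{d+1}` as a real number. [folklore] -/
private theorem card_torus_real' : (Fintype.card (FermionTorus (d + 1) L) : ℝ) = (L : ℝ) ^ (d + 1) := by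
  simp only [FermionTorus, Fintype.card_lex, Fintype.card_fun, Fintype.card_fin, Nat.cast_pow]

/-- One elementary hopping expectation with a `π`-flux amplitude on a bond: `|Re⟨T_π(x,x+e_μ) c†_i c_j⟩| ≤ κ`
and the same for `T_π(x+e_μ,x)` (`|T_π| = κ`, `|Re⟨c†c⟩| ≤ 1`). [cite: Koma2022, (6.26)] -/
theorem abs_re_gibbsState_piFlux_hop_le (h3 : 3 ≤ L) {κ : ℝ} (hκ : 0 ≤ κ) (β : ℝ)
    {H : Matrix (Finset (Orb (FermionTorus (d + 1) L))) (Finset (Orb (FermionTorus (d + 1) L))) ℂ} (hH : H.IsHermitian)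
    (σ : Fin 2) (x : FermionTorus (d + 1) L) (μ : Fin (d + 1)) (i j : Orb (FermionTorus (d + 1) L)) :
    |(gibbsState β H (piFluxAmpl κ σ x (shift x μ) • (creation i * annihilation j))).re| ≤ κ ∧
      |(gibbsState β H (piFluxAmpl κ σ (shift x μ) x • (creation i * annihilation j))).re| ≤ κ := by
  have hb := abs_re_gibbsState_hop_le_one β hH i j
  rw [abs_le] at hb
  rw [piFluxAmpl_shift h3, piFluxAmpl_shift' h3, map_smul, smul_eq_mul, Complex.re_ofReal_mul, abs_le]
  rcases bondSign_sign x μ with hs | hs <;> rw [hs] <;> constructor <;> constructor <;> nlinarith [hb.1, hb.2]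

/-- **`|Re⟨K(T_π)⟩| ≤ 4(d+1)κ|Λ|`** in the Gibbs state of any Hermitian `H'` (`2(d+1)|Λ|` ordered bonds, two
spins, `|Re⟨T c†c⟩| ≤ κ`). [cite: Koma2022, (6.26), App. B (B.2)] -/
theorem abs_re_gibbsState_piFlux_hopping_le (h3 : 3 ≤ L) {κ : ℝ} (hκ : 0 ≤ κ) (β : ℝ)
    {H : Matrix (Finset (Orb (FermionTorus (d + 1) L))) (Finset (Orb (FermionTorus (d + 1) L))) ℂ} (hH : H.IsHermitian) :
    |(gibbsState β H (peierlsHubbard (G d L) (piFluxAmpl κ) 0)).re| ≤ 4 * (d + 1) * κ * (L : ℝ) ^ (d + 1) := by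
  rw [peierlsHubbard_zero_eq, map_neg, Complex.neg_re, abs_neg]
  have hsum : (∑ a : FermionTorus (d + 1) L, ∑ b : FermionTorus (d + 1) L, ∑ σ : Fin 2,
      if (G d L).Adj a b then piFluxAmpl κ σ a b • (creation (orb a σ) * annihilation (orb b σ)) else 0) =
      ∑ x : FermionTorus (d + 1) L, ∑ μ : Fin (d + 1),
        ((∑ σ : Fin 2, piFluxAmpl κ σ x (shift x μ) • (creation (orb x σ) * annihilation (orb (shift x μ) σ))) +
          ∑ σ : Fin 2, piFluxAmpl κ σ (shift x μ) x • (creation (orb (shift x μ) σ) * annihilation (orb x σ))) := by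
    rw [sum_shift_add_sum_shift_swap h3 (fun a b => ∑ σ : Fin 2, piFluxAmpl κ σ a b • (creation (orb a σ) * annihilation (orb b σ)))]
    refine Finset.sum_congr rfl fun a _ => Finset.sum_congr rfl fun b _ => ?_
    split_ifs
    · rfl
    · simp
  rw [hsum, map_sum, Complex.re_sum]
  refine (Finset.abs_sum_le_sum_abs _ _).trans ?_
  have hx : ∀ x : FermionTorus (d + 1) L, |(gibbsState β H (∑ μ : Fin (d + 1),
      ((∑ σ : Fin 2, piFluxAmpl κ σ x (shift x μ) • (creation (orb x σ) * annihilation (orb (shift x μ) σ))) +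
        ∑ σ : Fin 2, piFluxAmpl κ σ (shift x μ) x • (creation (orb (shift x μ) σ) * annihilation (orb x σ))))).re| ≤
      (d + 1) * (4 * κ) := by
    intro x
    rw [map_sum, Complex.re_sum]
    refine (Finset.abs_sum_le_sum_abs _ _).trans ?_
    calc ∑ μ : Fin (d + 1), |(gibbsState β H
          ((∑ σ : Fin 2, piFluxAmpl κ σ x (shift x μ) • (creation (orb x σ) * annihilation (orb (shift x μ) σ))) +
            ∑ σ : Fin 2, piFluxAmpl κ σ (shift x μ) x • (creation (orb (shift x μ) σ) * annihilation (orb x σ)))).re|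
        ≤ ∑ _μ : Fin (d + 1), 4 * κ := by
          refine Finset.sum_le_sum fun μ _ => ?_
          rw [map_add, Complex.add_re, Fin.sum_univ_two, Fin.sum_univ_two, map_add, map_add, Complex.add_re, Complex.add_re]
          have h00 := (abs_re_gibbsState_piFlux_hop_le h3 hκ β hH 0 x μ (orb x 0) (orb (shift x μ) 0)).1
          have h01 := (abs_re_gibbsState_piFlux_hop_le h3 hκ β hH 1 x μ (orb x 1) (orb (shift x μ) 1)).1
          have h10 := (abs_re_gibbsState_piFlux_hop_le h3 hκ β hH 0 x μ (orb (shift x μ) 0) (orb x 0)).2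
          have h11 := (abs_re_gibbsState_piFlux_hop_le h3 hκ β hH 1 x μ (orb (shift x μ) 1) (orb x 1)).2
          rw [abs_le] at h00 h01 h10 h11 ⊢
          constructor <;> linarith [h00.1, h00.2, h01.1, h01.2, h10.1, h10.2, h11.1, h11.2]
      _ = (d + 1) * (4 * κ) := by rw [Finset.sum_const, Finset.card_univ, Fintype.card_fin, nsmul_eq_mul, Nat.cast_add, Nat.cast_one]
  calc ∑ x : FermionTorus (d + 1) L, |(gibbsState β H (∑ μ : Fin (d + 1),
        ((∑ σ : Fin 2, piFluxAmpl κ σ x (shift x μ) • (creation (orb x σ) * annihilation (orb (shift x μ) σ))) +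
          ∑ σ : Fin 2, piFluxAmpl κ σ (shift x μ) x • (creation (orb (shift x μ) σ) * annihilation (orb x σ))))).re|
      ≤ ∑ _x : FermionTorus (d + 1) L, (d + 1) * (4 * κ) := Finset.sum_le_sum fun x _ => hx x
    _ = 4 * (d + 1) * κ * (L : ℝ) ^ (d + 1) := by
        rw [Finset.sum_const, Finset.card_univ, nsmul_eq_mul, card_torus_real']; ring

/-- **The diagonal of the hopping kernel sums to `-2K`**: `|Σ_x Re⟨[Γ¹_x,[K(T_π),Γ¹_x]]⟩| ≤ 8(d+1)κ|Λ|`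
in the Gibbs state of any Hermitian `H'`. [cite: Koma2022, (6.26)] -/
theorem abs_sum_re_gibbsState_dcOp_hopping_diag_le (h3 : 3 ≤ L) {κ : ℝ} (hκ : 0 ≤ κ) (β : ℝ)
    {H : Matrix (Finset (Orb (FermionTorus (d + 1) L))) (Finset (Orb (FermionTorus (d + 1) L))) ℂ} (hH : H.IsHermitian) :
    |∑ x : FermionTorus (d + 1) L, (gibbsState β H (dcOp (peierlsHubbard (G d L) (piFluxAmpl κ) 0) x x)).re| ≤
      8 * (d + 1) * κ * (L : ℝ) ^ (d + 1) := by
  have h := abs_re_gibbsState_piFlux_hopping_le h3 hκ β hH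
  simp only [dcOp]
  rw [← Complex.re_sum, ← map_sum, sum_gammaOne_doubleComm_hopping, map_smul, smul_eq_mul, neg_mul, Complex.neg_re,
    abs_neg, show (2 : ℂ) = ((2 : ℝ) : ℂ) by norm_num, Complex.re_ofReal_mul, abs_mul, abs_two]
  linarith

/-- The off-diagonal hopping kernel in a Gibbs state: `|Re⟨[Γ¹_x,[K(T_π),Γ¹_{x+e_μ}]]⟩| ≤ 4κ` and the
same for the bond `(x+e_μ, x)`. [cite: Koma2022, (6.26)] -/
theorem abs_re_gibbsState_dcOp_hopping_shift_le (h3 : 3 ≤ L) {κ : ℝ} (hκ : 0 ≤ κ) (β : ℝ)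
    {H : Matrix (Finset (Orb (FermionTorus (d + 1) L))) (Finset (Orb (FermionTorus (d + 1) L))) ℂ} (hH : H.IsHermitian)
    (x : FermionTorus (d + 1) L) (μ : Fin (d + 1)) :
    |(gibbsState β H (dcOp (peierlsHubbard (G d L) (piFluxAmpl κ) 0) x (shift x μ))).re| ≤ 4 * κ ∧
      |(gibbsState β H (dcOp (peierlsHubbard (G d L) (piFluxAmpl κ) 0) (shift x μ) x)).re| ≤ 4 * κ := by
  have h2 : 2 ≤ L := by omega
  have hadj : (G d L).Adj x (shift x μ) := adj_shift h2 x μ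
  have hne : x ≠ shift x μ := hadj.ne
  constructor
  · rw [dcOp, gammaOne_doubleComm_hopping_of_ne (G d L) hne, if_pos hadj, map_add, map_add, map_add, Complex.add_re,
      Complex.add_re, Complex.add_re]
    have h1 := (abs_re_gibbsState_piFlux_hop_le h3 hκ β hH 0 x μ (orb (shift x μ) 1) (orb x 1)).1
    have h2' := (abs_re_gibbsState_piFlux_hop_le h3 hκ β hH 1 x μ (orb (shift x μ) 0) (orb x 0)).1
    have h3' := (abs_re_gibbsState_piFlux_hop_le h3 hκ β hH 0 x μ (orb x 1) (orb (shift x μ) 1)).2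
    have h4 := (abs_re_gibbsState_piFlux_hop_le h3 hκ β hH 1 x μ (orb x 0) (orb (shift x μ) 0)).2
    rw [abs_le] at h1 h2' h3' h4 ⊢
    constructor <;> linarith [h1.1, h1.2, h2'.1, h2'.2, h3'.1, h3'.2, h4.1, h4.2]
  · rw [dcOp, gammaOne_doubleComm_hopping_of_ne (G d L) (Ne.symm hne), if_pos hadj.symm, map_add, map_add, map_add,
      Complex.add_re, Complex.add_re, Complex.add_re]
    have h1 := (abs_re_gibbsState_piFlux_hop_le h3 hκ β hH 0 x μ (orb x 1) (orb (shift x μ) 1)).2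
    have h2' := (abs_re_gibbsState_piFlux_hop_le h3 hκ β hH 1 x μ (orb x 0) (orb (shift x μ) 0)).2
    have h3' := (abs_re_gibbsState_piFlux_hop_le h3 hκ β hH 0 x μ (orb (shift x μ) 1) (orb x 1)).1
    have h4 := (abs_re_gibbsState_piFlux_hop_le h3 hκ β hH 1 x μ (orb (shift x μ) 0) (orb x 0)).1
    rw [abs_le] at h1 h2' h3' h4 ⊢
    constructor <;> linarith [h1.1, h1.2, h2'.1, h2'.2, h3'.1, h3'.2, h4.1, h4.2]

/-- **The pointwise hopping bound** (Koma's (6.26), momentum-resolved, crude constant): in the Gibbs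
state of ANY Hermitian `H'`, for every momentum `p`, `κ ≥ 0`, `L ≥ 3`:
`|Re⟨hopDC κ p⟩_{β,H'}| ≤ 16(d+1)κ L^{d+1}` (diagonal `8Dκ` per site, each of the `2D` ordered bonds at a
site at most `4κ|cos| ≤ 4κ`). [cite: Koma2022, (6.26)] -/
theorem abs_re_gibbsState_hopDC_le (h3 : 3 ≤ L) {κ : ℝ} (hκ : 0 ≤ κ) (β : ℝ)
    {H : Matrix (Finset (Orb (FermionTorus (d + 1) L))) (Finset (Orb (FermionTorus (d + 1) L))) ℂ} (hH : H.IsHermitian)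
    (p : TorusSite (d + 1) L) :
    |(gibbsState β H (hopDC κ p)).re| ≤ 16 * (d + 1) * κ * (L : ℝ) ^ (d + 1) := by
  have h2 : 2 ≤ L := by omega
  set K := peierlsHubbard (G d L) (piFluxAmpl κ) 0 with hK
  -- split the kernel into its diagonal and its adjacent (off-diagonal) part; the rest vanishes
  have hker : ∀ x y : FermionTorus (d + 1) L,
      (gibbsState β H ((Real.cos (torusPhase L p (toTorusSite x - toTorusSite y)) : ℂ) • dcOp K x y)).re =
        (if x = y then (gibbsState β H (dcOp K x x)).re else 0) +
        (if (G d L).Adj x y then Real.cos (torusPhase L p (toTorusSite x - toTorusSite y)) * (gibbsState β H (dcOp K x y)).re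
          else 0) := by
    intro x y
    rw [map_smul, smul_eq_mul, Complex.re_ofReal_mul]
    by_cases hxy : x = y
    · subst hxy
      rw [if_pos rfl, if_neg (G d L).irrefl, add_zero, sub_self, torusPhase_zero_right, Real.cos_zero, one_mul]
    · rw [if_neg hxy, zero_add]
      split_ifs with hadj
      · rfl
      · rw [hK, dcOp, gammaOne_doubleComm_hopping_of_ne (G d L) hxy, if_neg hadj, map_zero, Complex.zero_re, mul_zero]
  rw [hopDC, ← hK, map_sum, Complex.re_sum]
  simp_rw [map_sum, Complex.re_sum, hker, Finset.sum_add_distrib, Finset.sum_ite_eq, Finset.mem_univ, if_true]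
  rw [← sum_shift_add_sum_shift_swap h3 (fun x y =>
    Real.cos (torusPhase L p (toTorusSite x - toTorusSite y)) * (gibbsState β H (dcOp K x y)).re)]
  have hdiag : |∑ x : FermionTorus (d + 1) L, (gibbsState β H (dcOp K x x)).re| ≤ 8 * (d + 1) * κ * (L : ℝ) ^ (d + 1) :=
    abs_sum_re_gibbsState_dcOp_hopping_diag_le h3 hκ β hH
  have hoff : |∑ x : FermionTorus (d + 1) L, ∑ μ : Fin (d + 1),
      (Real.cos (torusPhase L p (toTorusSite x - toTorusSite (shift x μ))) * (gibbsState β H (dcOp K x (shift x μ))).re +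
        Real.cos (torusPhase L p (toTorusSite (shift x μ) - toTorusSite x)) * (gibbsState β H (dcOp K (shift x μ) x)).re)| ≤
      8 * (d + 1) * κ * (L : ℝ) ^ (d + 1) := by
    refine (Finset.abs_sum_le_sum_abs _ _).trans ?_
    have hx : ∀ x : FermionTorus (d + 1) L, |∑ μ : Fin (d + 1),
        (Real.cos (torusPhase L p (toTorusSite x - toTorusSite (shift x μ))) * (gibbsState β H (dcOp K x (shift x μ))).re +
          Real.cos (torusPhase L p (toTorusSite (shift x μ) - toTorusSite x)) * (gibbsState β H (dcOp K (shift x μ) x)).re)| ≤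
        (d + 1) * (8 * κ) := by
      intro x
      refine (Finset.abs_sum_le_sum_abs _ _).trans ?_
      calc ∑ μ : Fin (d + 1), |Real.cos (torusPhase L p (toTorusSite x - toTorusSite (shift x μ))) *
              (gibbsState β H (dcOp K x (shift x μ))).re +
            Real.cos (torusPhase L p (toTorusSite (shift x μ) - toTorusSite x)) * (gibbsState β H (dcOp K (shift x μ) x)).re|
          ≤ ∑ _μ : Fin (d + 1), 8 * κ := by
            refine Finset.sum_le_sum fun μ _ => ?_
            have hb := abs_re_gibbsState_dcOp_hopping_shift_le h3 hκ β hH x μ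
            have hc1 := Real.abs_cos_le_one (torusPhase L p (toTorusSite x - toTorusSite (shift x μ)))
            have hc2 := Real.abs_cos_le_one (torusPhase L p (toTorusSite (shift x μ) - toTorusSite x))
            refine (abs_add_le _ _).trans ?_
            rw [abs_mul, abs_mul]
            nlinarith [hb.1, hb.2, abs_nonneg (Real.cos (torusPhase L p (toTorusSite x - toTorusSite (shift x μ)))),
              abs_nonneg (Real.cos (torusPhase L p (toTorusSite (shift x μ) - toTorusSite x))),
              abs_nonneg ((gibbsState β H (dcOp K x (shift x μ))).re), abs_nonneg ((gibbsState β H (dcOp K (shift x μ) x)).re)]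
        _ = (d + 1) * (8 * κ) := by rw [Finset.sum_const, Finset.card_univ, Fintype.card_fin, nsmul_eq_mul, Nat.cast_add, Nat.cast_one]
    calc ∑ x : FermionTorus (d + 1) L, |∑ μ : Fin (d + 1),
          (Real.cos (torusPhase L p (toTorusSite x - toTorusSite (shift x μ))) * (gibbsState β H (dcOp K x (shift x μ))).re +
            Real.cos (torusPhase L p (toTorusSite (shift x μ) - toTorusSite x)) * (gibbsState β H (dcOp K (shift x μ) x)).re)|
        ≤ ∑ _x : FermionTorus (d + 1) L, (d + 1) * (8 * κ) := Finset.sum_le_sum fun x _ => hx x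
      _ = 8 * (d + 1) * κ * (L : ℝ) ^ (d + 1) := by
          rw [Finset.sum_const, Finset.card_univ, nsmul_eq_mul, card_torus_real']; ring
  have := abs_add_le (∑ x : FermionTorus (d + 1) L, (gibbsState β H (dcOp K x x)).re)
    (∑ x : FermionTorus (d + 1) L, ∑ μ : Fin (d + 1),
      (Real.cos (torusPhase L p (toTorusSite x - toTorusSite (shift x μ))) * (gibbsState β H (dcOp K x (shift x μ))).re +
        Real.cos (torusPhase L p (toTorusSite (shift x μ) - toTorusSite x)) * (gibbsState β H (dcOp K (shift x μ) x)).re))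
  linarith

/-- **The pointwise double commutator of the modes in the Gibbs state of `H₀`** ((6.28) + (6.26)):
for `H₀ = H(κ,U,g,0,0)`, `κ ≥ 0`, `L ≥ 3`, every `β` and every momentum `p`,
`doubleComm C_p + doubleComm S_p = Re⟨hopDC κ p⟩ + 4g Σ_μ N²_μ - 4g Σ_μ cos(p_μ) N³_μ` with
`N^a_μ = Σ_x Re⟨Γ^a_xΓ^a_{x+e_μ}⟩_{β,H₀}` and `|Re⟨hopDC κ p⟩| ≤ 16(d+1)κL^{d+1}`. [cite: Koma2022, (6.26)–(6.28)] -/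
theorem doubleComm_modes_pointwise_eq (h3 : 3 ≤ L) (β κ U g : ℝ) (p : TorusSite (d + 1) L) :
    doubleComm β (hamiltonian κ U g (fun (_ _ : FermionTorus (d + 1) L) => (0 : ℝ)) 0) (gammaOneMode (cosWave p)) +
        doubleComm β (hamiltonian κ U g (fun (_ _ : FermionTorus (d + 1) L) => (0 : ℝ)) 0) (gammaOneMode (sinWave p)) =
      (gibbsState β (hamiltonian κ U g (fun (_ _ : FermionTorus (d + 1) L) => (0 : ℝ)) 0) (hopDC κ p)).re +
        4 * g * ∑ μ : Fin (d + 1), ∑ x : FermionTorus (d + 1) L,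
          (gibbsState β (hamiltonian κ U g (fun (_ _ : FermionTorus (d + 1) L) => (0 : ℝ)) 0) (gammaTwo x * gammaTwo (shift x μ))).re -
        4 * g * ∑ μ : Fin (d + 1), Real.cos (latticeMomentum L p μ) *
          ∑ x : FermionTorus (d + 1) L,
            (gibbsState β (hamiltonian κ U g (fun (_ _ : FermionTorus (d + 1) L) => (0 : ℝ)) 0) (gammaThree x * gammaThree (shift x μ))).re := by
  rw [doubleComm_eq_re_gibbsState_modeDC, doubleComm_eq_re_gibbsState_modeDC]
  exact re_modes_doubleComm_eq h3 κ U g p _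

end KomaPiFlux

end Literature.MathematicalPhysics.QuantumLattice

end
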